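import Literature.NumberTheory.DiophantineGeometry.AbcShapeExponents
import Literature.NumberTheory.DiophantineGeometry.AbcLinearProgram
import HarnessLib

/-!
# Feeding the shape data into the linear programme (BBLT §6, proof of Theorem 1.3)

For shape data `(c; X, Y, Z)` in dimension `6 + e` at scale `C₀` with `cᵢ ∏ ·^{i+1} ≤ 2C₀ = Λ`,
`C₀ ≤ V₂ c₃ ∏ Zᵢ^{i+1}` and `∏ XᵢYᵢZᵢ ≤ Λ^t`, `t ≤ 1` (this is where `λ < 1` enters), the
exponents `aᵢ = log_Λ X_{i-1}` (`i ≤ 6`), `a = Σ log_Λ Xᵢ`, …, `D = log_Λ B_d` satisfy the 22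
hypotheses of `AbcShapes.linear_program` ([BernertEtAl2024, Prop. 6.1]) with the slack
`s = (12d+3) log_Λ D_τ + 30 log_Λ 2 + log_Λ V₂` (`trivial_linear`, `geometry_disjunction` for the
13 index-set choices of [BernertEtAl2024, §6], `fourier_linear` for the 27 choices of saved sets),
whence (`AbcShapes.logb_shapeCount_le`)

> `log_Λ B_d ≤ 3/5 + 2s`.

Theorems 1.2/1.3 (named facts of `AbcExceptionalSetBounds`) are NOT proved here; the final
constant bookkeeping and the discharge of Theorem 1.3 are in `AbcShapeEndgame13` /
`AbcExceptionalSetBoundsMainProofs`.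

## References

* [BernertEtAl2024] C. Bernert, T. Browning, J. D. Lichtman, J. Teräväinen, *Bounds on the
  exceptional set in the abc conjecture*, arXiv:2410.12234v2, §6 (proof of Theorem 1.3),
  Proposition 6.1.
-/

noncomputable section

open Finset

namespace Literature.NumberTheory.DiophantineGeometry

namespace AbcShapes

/-- Three maxima of three options each are bounded by `R` as soon as all `27` combinations are.
[folklore] -/
theorem max3_add_max3_add_max3_le {u0 u1 u2 v0 v1 v2 w0 w1 w2 R : ℝ}
    (h000 : u0 + v0 + w0 ≤ R) (h001 : u0 + v0 + w1 ≤ R) (h002 : u0 + v0 + w2 ≤ R)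
    (h010 : u0 + v1 + w0 ≤ R) (h011 : u0 + v1 + w1 ≤ R) (h012 : u0 + v1 + w2 ≤ R)
    (h020 : u0 + v2 + w0 ≤ R) (h021 : u0 + v2 + w1 ≤ R) (h022 : u0 + v2 + w2 ≤ R)
    (h100 : u1 + v0 + w0 ≤ R) (h101 : u1 + v0 + w1 ≤ R) (h102 : u1 + v0 + w2 ≤ R)
    (h110 : u1 + v1 + w0 ≤ R) (h111 : u1 + v1 + w1 ≤ R) (h112 : u1 + v1 + w2 ≤ R)
    (h120 : u1 + v2 + w0 ≤ R) (h121 : u1 + v2 + w1 ≤ R) (h122 : u1 + v2 + w2 ≤ R)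
    (h200 : u2 + v0 + w0 ≤ R) (h201 : u2 + v0 + w1 ≤ R) (h202 : u2 + v0 + w2 ≤ R)
    (h210 : u2 + v1 + w0 ≤ R) (h211 : u2 + v1 + w1 ≤ R) (h212 : u2 + v1 + w2 ≤ R)
    (h220 : u2 + v2 + w0 ≤ R) (h221 : u2 + v2 + w1 ≤ R) (h222 : u2 + v2 + w2 ≤ R) :
    max (max u0 u1) u2 + max (max v0 v1) v2 + max (max w0 w1) w2 ≤ R := by
  have hw : ∀ {x y : ℝ}, x + y + w0 ≤ R → x + y + w1 ≤ R → x + y + w2 ≤ R →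
      max (max w0 w1) w2 ≤ R - x - y := fun h0 h1 h2 =>
    max_le (max_le (by linarith) (by linarith)) (by linarith)
  have hw0 := hw h000 h001 h002; have hw1 := hw h010 h011 h012; have hw2 := hw h020 h021 h022
  have hw3 := hw h100 h101 h102; have hw4 := hw h110 h111 h112; have hw5 := hw h120 h121 h122
  have hw6 := hw h200 h201 h202; have hw7 := hw h210 h211 h212; have hw8 := hw h220 h221 h222
  have hv : ∀ {x : ℝ}, max (max w0 w1) w2 ≤ R - x - v0 → max (max w0 w1) w2 ≤ R - x - v1 →
      max (max w0 w1) w2 ≤ R - x - v2 → max (max v0 v1) v2 ≤ R - x - max (max w0 w1) w2 :=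
    fun h0 h1 h2 => max_le (max_le (by linarith) (by linarith)) (by linarith)
  have hv0 := hv hw0 hw1 hw2; have hv1 := hv hw3 hw4 hw5; have hv2 := hv hw6 hw7 hw8
  have hu : max (max u0 u1) u2 ≤ R - max (max v0 v1) v2 - max (max w0 w1) w2 :=
    max_le (max_le (by linarith) (by linarith)) (by linarith)
  linarith

/-- `Σᵢ f i` over `Fin (6 + e)` dominates the first six terms when `f ≥ 0`. [folklore] -/
theorem six_le_sum {e : ℕ} {f : Fin (6 + e) → ℝ} (hf : ∀ i, 0 ≤ f i) :
    f (Fin.castAdd e 0) + f (Fin.castAdd e 1) + f (Fin.castAdd e 2) + f (Fin.castAdd e 3) +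
      f (Fin.castAdd e 4) + f (Fin.castAdd e 5) ≤ ∑ i, f i := by
  rw [Fin.sum_univ_add, Fin.sum_univ_six]
  linarith [sum_nonneg fun (i : Fin e) (_ : i ∈ univ) => hf (Fin.natAdd 6 i)]

/-- The weighted constraint `Σᵢ (i+1) f i ≤ 1` gives `7 Σᵢ f i - 1 ≤ 6f₀ + 5f₁ + … + f₅` for `f ≥ 0`
((6.3) of the source). [cite: BernertEtAl2024, Proposition 6.1] -/
theorem seven_mul_sum_sub_one_le {e : ℕ} {f : Fin (6 + e) → ℝ} (hf : ∀ i, 0 ≤ f i)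
    (h : ∑ i : Fin (6 + e), ((i : ℕ) + 1 : ℝ) * f i ≤ 1) :
    7 * ∑ i, f i - 1 ≤ 6 * f (Fin.castAdd e 0) + 5 * f (Fin.castAdd e 1) + 4 * f (Fin.castAdd e 2) +
      3 * f (Fin.castAdd e 3) + 2 * f (Fin.castAdd e 4) + f (Fin.castAdd e 5) := by
  rw [Fin.sum_univ_add, Fin.sum_univ_six] at h ⊢
  simp only [Fin.val_castAdd, Fin.val_natAdd, Fin.coe_ofNat_eq_mod, Nat.reduceMod, Nat.cast_zero,
    Nat.cast_one, Nat.cast_ofNat] at h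
  have htail : 7 * ∑ i : Fin e, f (Fin.natAdd 6 i) ≤
      ∑ i : Fin e, (((6 + (i : ℕ) : ℕ) : ℝ) + 1) * f (Fin.natAdd 6 i) := by
    rw [mul_sum]
    refine sum_le_sum fun i _ => mul_le_mul_of_nonneg_right ?_ (hf _)
    have : (0 : ℝ) ≤ ((i : ℕ) : ℝ) := Nat.cast_nonneg _
    push_cast; linarith
  linarith

/-- A sum over a three-element set. [folklore] -/
theorem sum_three {ι : Type*} [DecidableEq ι] {p q r : ι} (hpq : p ≠ q) (hpr : p ≠ r) (hqr : q ≠ r)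
    (f : ι → ℝ) : ∑ i ∈ ({p, q, r} : Finset ι), f i = f p + f q + f r := by
  rw [sum_insert (by simp [hpq, hpr]), sum_pair hqr]; ring

section instance_

variable {e : ℕ} {c₁ c₂ c₃ C₀ : ℕ} (hc₁ : 0 < c₁) (hc₂ : 0 < c₂) (hc₃ : 0 < c₃) (hC₀ : 1 ≤ C₀)
  {X Y Z : Fin (6 + e) → ℕ} (hX : ∀ i, 0 < X i) (hY : ∀ i, 0 < Y i) (hZ : ∀ i, 0 < Z i)
  {T Dτ : ℕ} (hTX : c₁ * shapeVal (fun i => 2 * X i) ≤ T) (hTY : c₂ * shapeVal (fun i => 2 * Y i) ≤ T)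
  (hTZ : c₃ * shapeVal (fun i => 2 * Z i) ≤ T) (hD : ∀ m : ℕ, m ≠ 0 → m ≤ T → m.divisors.card ≤ Dτ)
  (hC₀le : C₀ ≤ shapeVal (fun _ : Fin (6 + e) => 2) * (c₃ * shapeVal Z))
  (hvX : c₁ * shapeVal X ≤ 2 * C₀) (hvY : c₂ * shapeVal Y ≤ 2 * C₀) (hvZ : c₃ * shapeVal Z ≤ 2 * C₀)
  {t : ℝ} (hP : ∏ i, ((X i : ℝ) * Y i * Z i) ≤ (2 * C₀ : ℝ) ^ t) (ht : t ≤ 1)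
  (hB : 0 < shapeCount c₁ c₂ c₃ X Y Z)
include hc₁ hc₂ hc₃ hC₀ hX hY hZ hTX hTY hTZ hD hC₀le hvX hvY hvZ hP ht hB

set_option maxHeartbeats 400000 in
-- 13 + 27 instantiations and a 46-leaf linear programme: a long but elementary verification
/-- **`log_Λ B_d ≤ 3/5 + 2s`** for `Λ = 2C₀` and
`s = (12d+3) log_Λ D_τ + 30 log_Λ 2 + log_Λ V₂` (`d = 6 + e`): the 22 hypotheses of
`linear_program` hold for the exponents of the data. [cite: BernertEtAl2024, Proposition 6.1] -/
theorem logb_shapeCount_le :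
    Real.logb (2 * C₀) (shapeCount c₁ c₂ c₃ X Y Z) ≤ 3 / 5 + 2 *
      ((12 * ((6 + e : ℕ) : ℝ) + 3) * Real.logb (2 * C₀) Dτ + 30 * Real.logb (2 * C₀) 2 +
        Real.logb (2 * C₀) (shapeVal (fun _ : Fin (6 + e) => 2) : ℕ)) := by
  classical
  obtain ⟨Λ, hΛdef⟩ : ∃ Λ : ℝ, Λ = 2 * C₀ := ⟨_, rfl⟩
  rw [← hΛdef] at hP ⊢
  have hC₀' : (1 : ℝ) ≤ C₀ := by exact_mod_cast hC₀
  have hΛ : 1 < Λ := by rw [hΛdef]; linarith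
  have hΛ0 : 0 < Λ := by linarith
  have hDτ : 1 ≤ Dτ := by
    have h1 : (1 : ℕ) ≤ T :=
      le_trans (Nat.mul_pos hc₃ (shapeVal_pos fun i => Nat.mul_pos two_pos (hZ i))) hTZ
    simpa using hD 1 one_ne_zero h1
  have hd0 : (0 : ℝ) ≤ ((6 + e : ℕ) : ℝ) := Nat.cast_nonneg _
  have hlD0 : 0 ≤ Real.logb Λ Dτ := Real.logb_nonneg hΛ (by exact_mod_cast hDτ)
  have hl20 : 0 ≤ Real.logb Λ 2 := Real.logb_nonneg hΛ (by norm_num)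
  have hV2pos : 0 < shapeVal (fun _ : Fin (6 + e) => 2) := shapeVal_pos fun _ => two_pos
  have hlV0 : 0 ≤ Real.logb Λ (shapeVal (fun _ : Fin (6 + e) => 2) : ℕ) :=
    Real.logb_nonneg hΛ (by exact_mod_cast Nat.one_le_iff_ne_zero.mpr hV2pos.ne')
  obtain ⟨s, hs⟩ : ∃ s : ℝ, s = (12 * ((6 + e : ℕ) : ℝ) + 3) * Real.logb Λ Dτ + 30 * Real.logb Λ 2 +
      Real.logb Λ (shapeVal (fun _ : Fin (6 + e) => 2) : ℕ) := ⟨_, rfl⟩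
  rw [← hs]
  have hs0 : 0 ≤ s := by
    have := mul_nonneg (by linarith : (0 : ℝ) ≤ 12 * ((6 + e : ℕ) : ℝ) + 3) hlD0
    rw [hs]; linarith
  have hα0 : ∀ i, 0 ≤ expo Λ X i := expo_nonneg hΛ hX
  have hβ0 : ∀ i, 0 ≤ expo Λ Y i := expo_nonneg hΛ hY
  have hγ0 : ∀ i, 0 ≤ expo Λ Z i := expo_nonneg hΛ hZ
  -- the six special indices: distinctness and values
  have hne : ∀ {p q : Fin 6}, p ≠ q → (Fin.castAdd e p : Fin (6 + e)) ≠ Fin.castAdd e q :=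
    fun h h' => h (Fin.castAdd_injective _ _ h')
  have h01 := hne (show (0 : Fin 6) ≠ 1 by decide)
  have h02 := hne (show (0 : Fin 6) ≠ 2 by decide)
  have h03 := hne (show (0 : Fin 6) ≠ 3 by decide)
  have h12 := hne (show (1 : Fin 6) ≠ 2 by decide)
  have h13 := hne (show (1 : Fin 6) ≠ 3 by decide)
  have h15 := hne (show (1 : Fin 6) ≠ 5 by decide)
  have h25 := hne (show (2 : Fin 6) ≠ 5 by decide)
  have h35 := hne (show (3 : Fin 6) ≠ 5 by decide)
  have hv0 : ((Fin.castAdd e (0 : Fin 6) : Fin (6 + e)) : ℕ) = 0 := rfl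
  have hv1 : ((Fin.castAdd e (1 : Fin 6) : Fin (6 + e)) : ℕ) = 1 := rfl
  have hv2 : ((Fin.castAdd e (2 : Fin 6) : Fin (6 + e)) : ℕ) = 2 := rfl
  have hv3 : ((Fin.castAdd e (3 : Fin 6) : Fin (6 + e)) : ℕ) = 3 := rfl
  have hv4 : ((Fin.castAdd e (4 : Fin 6) : Fin (6 + e)) : ℕ) = 4 := rfl
  have hv5 : ((Fin.castAdd e (5 : Fin 6) : Fin (6 + e)) : ℕ) = 5 := rfl
  /- (6.1): `L ≤ 1` -/
  have h1 : ∑ i, expo Λ X i + ∑ i, expo Λ Y i + ∑ i, expo Λ Z i ≤ 1 + s := by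
    have hNX : 0 < (dyadicBox X).card := by rw [card_dyadicBox]; exact prod_pos fun i _ => hX i
    have hNY : 0 < (dyadicBox Y).card := by rw [card_dyadicBox]; exact prod_pos fun i _ => hY i
    have hNZ : 0 < (dyadicBox Z).card := by rw [card_dyadicBox]; exact prod_pos fun i _ => hZ i
    have hPeq : (((dyadicBox X).card * (dyadicBox Y).card * (dyadicBox Z).card : ℕ) : ℝ) =
        ∏ i, ((X i : ℝ) * Y i * Z i) := by
      rw [card_dyadicBox, card_dyadicBox, card_dyadicBox]; push_cast
      rw [← prod_mul_distrib, ← prod_mul_distrib]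
    have hpos : (0 : ℝ) < (((dyadicBox X).card * (dyadicBox Y).card * (dyadicBox Z).card : ℕ) : ℝ) := by
      exact_mod_cast Nat.mul_pos (Nat.mul_pos hNX hNY) hNZ
    have hlog : Real.logb Λ (((dyadicBox X).card * (dyadicBox Y).card * (dyadicBox Z).card : ℕ) : ℝ)
        ≤ t := by
      calc Real.logb Λ (((dyadicBox X).card * (dyadicBox Y).card * (dyadicBox Z).card : ℕ) : ℝ)
            ≤ Real.logb Λ (Λ ^ t) := Real.logb_le_logb_of_le hΛ hpos (by rw [hPeq]; exact hP)
        _ = t := Real.logb_rpow hΛ0 hΛ.ne'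
    rw [logb_natMul (Nat.mul_pos hNX hNY) hNZ, logb_natMul hNX hNY, logb_card_dyadicBox hX,
      logb_card_dyadicBox hY, logb_card_dyadicBox hZ] at hlog
    linarith
  /- (6.2) -/
  have h2a := six_le_sum hα0
  have h2b := six_le_sum hβ0
  have h2c := six_le_sum hγ0
  /- (6.3): `Σ (i+1) αᵢ ≤ 1` from `c₁ V(X) ≤ Λ` -/
  have hval1 : ∀ {cc : ℕ} {W : Fin (6 + e) → ℕ}, 0 < cc → (∀ i, 0 < W i) → cc * shapeVal W ≤ 2 * C₀ →
      ∑ i : Fin (6 + e), ((i : ℕ) + 1 : ℝ) * expo Λ W i ≤ 1 := by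
    intro cc W hcc hW hv
    rw [← logb_shapeVal hW]
    calc Real.logb Λ (shapeVal W : ℕ) ≤ Real.logb Λ ((2 * C₀ : ℕ) : ℝ) :=
          logb_natMono hΛ (shapeVal_pos hW) ((Nat.le_mul_of_pos_left _ hcc).trans hv)
      _ = 1 := by push_cast; rw [← hΛdef]; exact Real.logb_self_eq_one hΛ
  have h3a := seven_mul_sum_sub_one_le hα0 (hval1 hc₁ hX hvX)
  have h3b := seven_mul_sum_sub_one_le hβ0 (hval1 hc₂ hY hvY)
  have h3c := seven_mul_sum_sub_one_le hγ0 (hval1 hc₃ hZ hvZ)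
  /- (6.4) -/
  obtain ⟨h4ab, h4ac, h4bc⟩ := trivial_linear hc₁ hc₂ hc₃ hX hY hZ hTX hTY hTZ hD hΛ hB
  have hdlD : ((6 + e : ℕ) : ℝ) * Real.logb Λ Dτ ≤ s := by
    have : ((6 + e : ℕ) : ℝ) * Real.logb Λ Dτ ≤ (12 * ((6 + e : ℕ) : ℝ) + 3) * Real.logb Λ Dτ :=
      mul_le_mul_of_nonneg_right (by linarith) hlD0
    rw [hs]; linarith
  /- (6.5)–(6.9): the 13 geometry disjunctions -/
  have hgeo : ∀ (I J K : Finset (Fin (6 + e))),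
      (8 + ∑ i ∈ I, ((i : ℕ) + 1 : ℝ) + ∑ i ∈ J, ((i : ℕ) + 1 : ℝ)) ≤ 22 →
      (∑ i ∈ I, expo Λ X i + ∑ i ∈ J, expo Λ Y i + ∑ i ∈ K, expo Λ Z i ≤
        (∑ i, expo Λ X i + ∑ i, expo Λ Y i + ∑ i, expo Λ Z i) -
          Real.logb Λ (shapeCount c₁ c₂ c₃ X Y Z) + s) ∨
      (1 - (∑ i ∈ I, (i : ℝ) * expo Λ X i + ∑ i ∈ J, (i : ℝ) * expo Λ Y i +
          ∑ i ∈ K, (i : ℝ) * expo Λ Z i) ≤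
        (∑ i, expo Λ X i + ∑ i, expo Λ Y i + ∑ i, expo Λ Z i) -
          Real.logb Λ (shapeCount c₁ c₂ c₃ X Y Z) + s) := by
    intro I J K hIJ
    refine geometry_disjunction hc₁ hc₂ hc₃ hX hY hZ hTX hTY hTZ hD hΛ hB hC₀ hΛdef hC₀le I J K ?_
    have h22 : (8 + ∑ i ∈ I, ((i : ℕ) + 1 : ℝ) + ∑ i ∈ J, ((i : ℕ) + 1 : ℝ)) * Real.logb Λ 2 ≤
        22 * Real.logb Λ 2 := mul_le_mul_of_nonneg_right hIJ hl20
    have h3d : 3 * ((6 + e : ℕ) : ℝ) * Real.logb Λ Dτ ≤ (12 * ((6 + e : ℕ) : ℝ) + 3) * Real.logb Λ Dτ :=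
      mul_le_mul_of_nonneg_right (by linarith) hlD0
    rw [hs]; linarith
  have wsum3 : ∀ {p q r : Fin (6 + e)}, p ≠ q → p ≠ r → q ≠ r →
      ∑ i ∈ ({p, q, r} : Finset (Fin (6 + e))), ((i : ℕ) + 1 : ℝ) =
        ((p : ℕ) + 1 : ℝ) + ((q : ℕ) + 1) + ((r : ℕ) + 1) :=
    fun hpq hpr hqr => sum_three hpq hpr hqr _
  have wsum2 : ∀ {p q : Fin (6 + e)}, p ≠ q →
      ∑ i ∈ ({p, q} : Finset (Fin (6 + e))), ((i : ℕ) + 1 : ℝ) = ((p : ℕ) + 1 : ℝ) + ((q : ℕ) + 1) :=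
    fun hpq => sum_pair hpq
  have g5 := hgeo ({Fin.castAdd e 0, Fin.castAdd e 1, Fin.castAdd e 3} : Finset (Fin (6 + e))) ({Fin.castAdd e 0, Fin.castAdd e 1, Fin.castAdd e 3} : Finset (Fin (6 + e))) ({Fin.castAdd e 0, Fin.castAdd e 1, Fin.castAdd e 3} : Finset (Fin (6 + e)))
    (by rw [wsum3 h01 h03 h13, hv0, hv1, hv3]; norm_num)
  have g6a := hgeo ({Fin.castAdd e 0, Fin.castAdd e 1, Fin.castAdd e 2} : Finset (Fin (6 + e))) ({Fin.castAdd e 0, Fin.castAdd e 1} : Finset (Fin (6 + e))) ({Fin.castAdd e 0, Fin.castAdd e 1} : Finset (Fin (6 + e)))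
    (by rw [wsum3 h01 h02 h12, wsum2 h01, hv0, hv1, hv2]; norm_num)
  have g6b := hgeo ({Fin.castAdd e 0, Fin.castAdd e 1} : Finset (Fin (6 + e))) ({Fin.castAdd e 0, Fin.castAdd e 1, Fin.castAdd e 2} : Finset (Fin (6 + e))) ({Fin.castAdd e 0, Fin.castAdd e 1} : Finset (Fin (6 + e)))
    (by rw [wsum2 h01, wsum3 h01 h02 h12, hv0, hv1, hv2]; norm_num)
  have g6c := hgeo ({Fin.castAdd e 0, Fin.castAdd e 1} : Finset (Fin (6 + e))) ({Fin.castAdd e 0, Fin.castAdd e 1} : Finset (Fin (6 + e))) ({Fin.castAdd e 0, Fin.castAdd e 1, Fin.castAdd e 2} : Finset (Fin (6 + e)))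
    (by rw [wsum2 h01, hv0, hv1]; norm_num)
  have g7ab := hgeo ({Fin.castAdd e 0, Fin.castAdd e 1, Fin.castAdd e 2} : Finset (Fin (6 + e))) ({Fin.castAdd e 0, Fin.castAdd e 1, Fin.castAdd e 2} : Finset (Fin (6 + e))) ({Fin.castAdd e 0, Fin.castAdd e 1} : Finset (Fin (6 + e)))
    (by rw [wsum3 h01 h02 h12, hv0, hv1, hv2]; norm_num)
  have g7bc := hgeo ({Fin.castAdd e 0, Fin.castAdd e 1} : Finset (Fin (6 + e))) ({Fin.castAdd e 0, Fin.castAdd e 1, Fin.castAdd e 2} : Finset (Fin (6 + e))) ({Fin.castAdd e 0, Fin.castAdd e 1, Fin.castAdd e 2} : Finset (Fin (6 + e)))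
    (by rw [wsum2 h01, wsum3 h01 h02 h12, hv0, hv1, hv2]; norm_num)
  have g7ca := hgeo ({Fin.castAdd e 0, Fin.castAdd e 1, Fin.castAdd e 2} : Finset (Fin (6 + e))) ({Fin.castAdd e 0, Fin.castAdd e 1} : Finset (Fin (6 + e))) ({Fin.castAdd e 0, Fin.castAdd e 1, Fin.castAdd e 2} : Finset (Fin (6 + e)))
    (by rw [wsum3 h01 h02 h12, wsum2 h01, hv0, hv1, hv2]; norm_num)
  have g8a := hgeo ({Fin.castAdd e 0, Fin.castAdd e 2} : Finset (Fin (6 + e))) ({Fin.castAdd e 0, Fin.castAdd e 1} : Finset (Fin (6 + e))) ({Fin.castAdd e 0, Fin.castAdd e 1} : Finset (Fin (6 + e)))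
    (by rw [wsum2 h02, wsum2 h01, hv0, hv1, hv2]; norm_num)
  have g8b := hgeo ({Fin.castAdd e 0, Fin.castAdd e 1} : Finset (Fin (6 + e))) ({Fin.castAdd e 0, Fin.castAdd e 2} : Finset (Fin (6 + e))) ({Fin.castAdd e 0, Fin.castAdd e 1} : Finset (Fin (6 + e)))
    (by rw [wsum2 h01, wsum2 h02, hv0, hv1, hv2]; norm_num)
  have g8c := hgeo ({Fin.castAdd e 0, Fin.castAdd e 1} : Finset (Fin (6 + e))) ({Fin.castAdd e 0, Fin.castAdd e 1} : Finset (Fin (6 + e))) ({Fin.castAdd e 0, Fin.castAdd e 2} : Finset (Fin (6 + e)))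
    (by rw [wsum2 h01, hv0, hv1]; norm_num)
  have g9a := hgeo ({Fin.castAdd e 0, Fin.castAdd e 1} : Finset (Fin (6 + e))) ({Fin.castAdd e 0, Fin.castAdd e 2} : Finset (Fin (6 + e))) ({Fin.castAdd e 0, Fin.castAdd e 2} : Finset (Fin (6 + e)))
    (by rw [wsum2 h01, wsum2 h02, hv0, hv1, hv2]; norm_num)
  have g9b := hgeo ({Fin.castAdd e 0, Fin.castAdd e 2} : Finset (Fin (6 + e))) ({Fin.castAdd e 0, Fin.castAdd e 1} : Finset (Fin (6 + e))) ({Fin.castAdd e 0, Fin.castAdd e 2} : Finset (Fin (6 + e)))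
    (by rw [wsum2 h02, wsum2 h01, hv0, hv1, hv2]; norm_num)
  have g9c := hgeo ({Fin.castAdd e 0, Fin.castAdd e 2} : Finset (Fin (6 + e))) ({Fin.castAdd e 0, Fin.castAdd e 2} : Finset (Fin (6 + e))) ({Fin.castAdd e 0, Fin.castAdd e 1} : Finset (Fin (6 + e)))
    (by rw [wsum2 h02, hv0, hv2]; norm_num)
  simp only [sum_pair h01, sum_pair h02, sum_three h01 h02 h12, sum_three h01 h03 h13, hv0, hv1, hv2, hv3, Nat.cast_zero, Nat.cast_one,
    Nat.cast_ofNat, zero_mul, one_mul, zero_add] at g5 g6a g6b g6c g7ab g7bc g7ca g8a g8b g8c g9a g9b g9c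
  /- (6.10): the Fourier bound for the 27 choices of saved sets -/
  have hfou : ∀ (SU SV SW : Finset (Fin (6 + e))) {eU eV eW : ℕ}, 2 ≤ eU → 2 ≤ eV → 2 ≤ eW →
      (∀ i ∈ SU, eU ∣ (i : ℕ) + 1) → (∀ i ∈ SV, eV ∣ (i : ℕ) + 1) → (∀ i ∈ SW, eW ∣ (i : ℕ) + 1) →
      ∑ i ∈ SU, expo Λ X i + ∑ i ∈ SV, expo Λ Y i + ∑ i ∈ SW, expo Λ Z i ≤
        4 * (∑ i, expo Λ X i + ∑ i, expo Λ Y i + ∑ i, expo Λ Z i) -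
          6 * Real.logb Λ (shapeCount c₁ c₂ c₃ X Y Z) + s := by
    intro SU SV SW eU eV eW heU heV heW hSU hSV hSW
    have h := fourier_linear hc₁ hc₂ hc₃ hX hY hZ hTX hTY hTZ hD hΛ hB SU SV SW heU heV heW hSU hSV hSW
    have h27 : Real.logb Λ 27 ≤ 5 * Real.logb Λ 2 := by
      have : Real.logb Λ 27 ≤ Real.logb Λ 32 := Real.logb_le_logb_of_le hΛ (by norm_num) (by norm_num)
      have h32 : Real.logb Λ 32 = 5 * Real.logb Λ 2 := by
        rw [show (32 : ℝ) = 2 ^ (5 : ℕ) by norm_num, ← Real.rpow_natCast,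
          Real.logb_rpow_eq_mul_logb_of_pos two_pos]; norm_num
      linarith
    rw [hs]; linarith
  -- the three families of saved sets: {1,3,5} (`e_T = 2`), {2,5} (`e_T = 3`), {4} (`e_T = 5`)

  have dv2 : ∀ i ∈ ({Fin.castAdd e 1, Fin.castAdd e 3, Fin.castAdd e 5} : Finset (Fin (6 + e))), 2 ∣ (i : ℕ) + 1 := by
    intro i hi
    simp only [mem_insert, mem_singleton] at hi
    rcases hi with rfl | rfl | rfl
    · exact ⟨1, rfl⟩
    · exact ⟨2, rfl⟩
    · exact ⟨3, rfl⟩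
  have dv3 : ∀ i ∈ ({Fin.castAdd e 2, Fin.castAdd e 5} : Finset (Fin (6 + e))), 3 ∣ (i : ℕ) + 1 := by
    intro i hi
    simp only [mem_insert, mem_singleton] at hi
    rcases hi with rfl | rfl
    · exact ⟨1, rfl⟩
    · exact ⟨2, rfl⟩
  have dv5 : ∀ i ∈ ({Fin.castAdd e 4} : Finset (Fin (6 + e))), 5 ∣ (i : ℕ) + 1 := by
    intro i hi
    simp only [mem_singleton] at hi
    subst hi
    exact ⟨1, rfl⟩
  have f000 := hfou ({Fin.castAdd e 1, Fin.castAdd e 3, Fin.castAdd e 5} : Finset (Fin (6 + e))) ({Fin.castAdd e 1, Fin.castAdd e 3, Fin.castAdd e 5} : Finset (Fin (6 + e))) ({Fin.castAdd e 1, Fin.castAdd e 3, Fin.castAdd e 5} : Finset (Fin (6 + e))) (le_refl 2) (le_refl 2) (le_refl 2) dv2 dv2 dv2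
  have f001 := hfou ({Fin.castAdd e 1, Fin.castAdd e 3, Fin.castAdd e 5} : Finset (Fin (6 + e))) ({Fin.castAdd e 1, Fin.castAdd e 3, Fin.castAdd e 5} : Finset (Fin (6 + e))) ({Fin.castAdd e 2, Fin.castAdd e 5} : Finset (Fin (6 + e))) (le_refl 2) (le_refl 2) (by norm_num) dv2 dv2 dv3
  have f002 := hfou ({Fin.castAdd e 1, Fin.castAdd e 3, Fin.castAdd e 5} : Finset (Fin (6 + e))) ({Fin.castAdd e 1, Fin.castAdd e 3, Fin.castAdd e 5} : Finset (Fin (6 + e))) ({Fin.castAdd e 4} : Finset (Fin (6 + e))) (le_refl 2) (le_refl 2) (by norm_num) dv2 dv2 dv5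
  have f010 := hfou ({Fin.castAdd e 1, Fin.castAdd e 3, Fin.castAdd e 5} : Finset (Fin (6 + e))) ({Fin.castAdd e 2, Fin.castAdd e 5} : Finset (Fin (6 + e))) ({Fin.castAdd e 1, Fin.castAdd e 3, Fin.castAdd e 5} : Finset (Fin (6 + e))) (le_refl 2) (by norm_num) (le_refl 2) dv2 dv3 dv2
  have f011 := hfou ({Fin.castAdd e 1, Fin.castAdd e 3, Fin.castAdd e 5} : Finset (Fin (6 + e))) ({Fin.castAdd e 2, Fin.castAdd e 5} : Finset (Fin (6 + e))) ({Fin.castAdd e 2, Fin.castAdd e 5} : Finset (Fin (6 + e))) (le_refl 2) (by norm_num) (by norm_num) dv2 dv3 dv3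
  have f012 := hfou ({Fin.castAdd e 1, Fin.castAdd e 3, Fin.castAdd e 5} : Finset (Fin (6 + e))) ({Fin.castAdd e 2, Fin.castAdd e 5} : Finset (Fin (6 + e))) ({Fin.castAdd e 4} : Finset (Fin (6 + e))) (le_refl 2) (by norm_num) (by norm_num) dv2 dv3 dv5
  have f020 := hfou ({Fin.castAdd e 1, Fin.castAdd e 3, Fin.castAdd e 5} : Finset (Fin (6 + e))) ({Fin.castAdd e 4} : Finset (Fin (6 + e))) ({Fin.castAdd e 1, Fin.castAdd e 3, Fin.castAdd e 5} : Finset (Fin (6 + e))) (le_refl 2) (by norm_num) (le_refl 2) dv2 dv5 dv2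
  have f021 := hfou ({Fin.castAdd e 1, Fin.castAdd e 3, Fin.castAdd e 5} : Finset (Fin (6 + e))) ({Fin.castAdd e 4} : Finset (Fin (6 + e))) ({Fin.castAdd e 2, Fin.castAdd e 5} : Finset (Fin (6 + e))) (le_refl 2) (by norm_num) (by norm_num) dv2 dv5 dv3
  have f022 := hfou ({Fin.castAdd e 1, Fin.castAdd e 3, Fin.castAdd e 5} : Finset (Fin (6 + e))) ({Fin.castAdd e 4} : Finset (Fin (6 + e))) ({Fin.castAdd e 4} : Finset (Fin (6 + e))) (le_refl 2) (by norm_num) (by norm_num) dv2 dv5 dv5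
  have f100 := hfou ({Fin.castAdd e 2, Fin.castAdd e 5} : Finset (Fin (6 + e))) ({Fin.castAdd e 1, Fin.castAdd e 3, Fin.castAdd e 5} : Finset (Fin (6 + e))) ({Fin.castAdd e 1, Fin.castAdd e 3, Fin.castAdd e 5} : Finset (Fin (6 + e))) (by norm_num) (le_refl 2) (le_refl 2) dv3 dv2 dv2
  have f101 := hfou ({Fin.castAdd e 2, Fin.castAdd e 5} : Finset (Fin (6 + e))) ({Fin.castAdd e 1, Fin.castAdd e 3, Fin.castAdd e 5} : Finset (Fin (6 + e))) ({Fin.castAdd e 2, Fin.castAdd e 5} : Finset (Fin (6 + e))) (by norm_num) (le_refl 2) (by norm_num) dv3 dv2 dv3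
  have f102 := hfou ({Fin.castAdd e 2, Fin.castAdd e 5} : Finset (Fin (6 + e))) ({Fin.castAdd e 1, Fin.castAdd e 3, Fin.castAdd e 5} : Finset (Fin (6 + e))) ({Fin.castAdd e 4} : Finset (Fin (6 + e))) (by norm_num) (le_refl 2) (by norm_num) dv3 dv2 dv5
  have f110 := hfou ({Fin.castAdd e 2, Fin.castAdd e 5} : Finset (Fin (6 + e))) ({Fin.castAdd e 2, Fin.castAdd e 5} : Finset (Fin (6 + e))) ({Fin.castAdd e 1, Fin.castAdd e 3, Fin.castAdd e 5} : Finset (Fin (6 + e))) (by norm_num) (by norm_num) (le_refl 2) dv3 dv3 dv2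
  have f111 := hfou ({Fin.castAdd e 2, Fin.castAdd e 5} : Finset (Fin (6 + e))) ({Fin.castAdd e 2, Fin.castAdd e 5} : Finset (Fin (6 + e))) ({Fin.castAdd e 2, Fin.castAdd e 5} : Finset (Fin (6 + e))) (by norm_num) (by norm_num) (by norm_num) dv3 dv3 dv3
  have f112 := hfou ({Fin.castAdd e 2, Fin.castAdd e 5} : Finset (Fin (6 + e))) ({Fin.castAdd e 2, Fin.castAdd e 5} : Finset (Fin (6 + e))) ({Fin.castAdd e 4} : Finset (Fin (6 + e))) (by norm_num) (by norm_num) (by norm_num) dv3 dv3 dv5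
  have f120 := hfou ({Fin.castAdd e 2, Fin.castAdd e 5} : Finset (Fin (6 + e))) ({Fin.castAdd e 4} : Finset (Fin (6 + e))) ({Fin.castAdd e 1, Fin.castAdd e 3, Fin.castAdd e 5} : Finset (Fin (6 + e))) (by norm_num) (by norm_num) (le_refl 2) dv3 dv5 dv2
  have f121 := hfou ({Fin.castAdd e 2, Fin.castAdd e 5} : Finset (Fin (6 + e))) ({Fin.castAdd e 4} : Finset (Fin (6 + e))) ({Fin.castAdd e 2, Fin.castAdd e 5} : Finset (Fin (6 + e))) (by norm_num) (by norm_num) (by norm_num) dv3 dv5 dv3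
  have f122 := hfou ({Fin.castAdd e 2, Fin.castAdd e 5} : Finset (Fin (6 + e))) ({Fin.castAdd e 4} : Finset (Fin (6 + e))) ({Fin.castAdd e 4} : Finset (Fin (6 + e))) (by norm_num) (by norm_num) (by norm_num) dv3 dv5 dv5
  have f200 := hfou ({Fin.castAdd e 4} : Finset (Fin (6 + e))) ({Fin.castAdd e 1, Fin.castAdd e 3, Fin.castAdd e 5} : Finset (Fin (6 + e))) ({Fin.castAdd e 1, Fin.castAdd e 3, Fin.castAdd e 5} : Finset (Fin (6 + e))) (by norm_num) (le_refl 2) (le_refl 2) dv5 dv2 dv2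
  have f201 := hfou ({Fin.castAdd e 4} : Finset (Fin (6 + e))) ({Fin.castAdd e 1, Fin.castAdd e 3, Fin.castAdd e 5} : Finset (Fin (6 + e))) ({Fin.castAdd e 2, Fin.castAdd e 5} : Finset (Fin (6 + e))) (by norm_num) (le_refl 2) (by norm_num) dv5 dv2 dv3
  have f202 := hfou ({Fin.castAdd e 4} : Finset (Fin (6 + e))) ({Fin.castAdd e 1, Fin.castAdd e 3, Fin.castAdd e 5} : Finset (Fin (6 + e))) ({Fin.castAdd e 4} : Finset (Fin (6 + e))) (by norm_num) (le_refl 2) (by norm_num) dv5 dv2 dv5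
  have f210 := hfou ({Fin.castAdd e 4} : Finset (Fin (6 + e))) ({Fin.castAdd e 2, Fin.castAdd e 5} : Finset (Fin (6 + e))) ({Fin.castAdd e 1, Fin.castAdd e 3, Fin.castAdd e 5} : Finset (Fin (6 + e))) (by norm_num) (by norm_num) (le_refl 2) dv5 dv3 dv2
  have f211 := hfou ({Fin.castAdd e 4} : Finset (Fin (6 + e))) ({Fin.castAdd e 2, Fin.castAdd e 5} : Finset (Fin (6 + e))) ({Fin.castAdd e 2, Fin.castAdd e 5} : Finset (Fin (6 + e))) (by norm_num) (by norm_num) (by norm_num) dv5 dv3 dv3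
  have f212 := hfou ({Fin.castAdd e 4} : Finset (Fin (6 + e))) ({Fin.castAdd e 2, Fin.castAdd e 5} : Finset (Fin (6 + e))) ({Fin.castAdd e 4} : Finset (Fin (6 + e))) (by norm_num) (by norm_num) (by norm_num) dv5 dv3 dv5
  have f220 := hfou ({Fin.castAdd e 4} : Finset (Fin (6 + e))) ({Fin.castAdd e 4} : Finset (Fin (6 + e))) ({Fin.castAdd e 1, Fin.castAdd e 3, Fin.castAdd e 5} : Finset (Fin (6 + e))) (by norm_num) (by norm_num) (le_refl 2) dv5 dv5 dv2
  have f221 := hfou ({Fin.castAdd e 4} : Finset (Fin (6 + e))) ({Fin.castAdd e 4} : Finset (Fin (6 + e))) ({Fin.castAdd e 2, Fin.castAdd e 5} : Finset (Fin (6 + e))) (by norm_num) (by norm_num) (by norm_num) dv5 dv5 dv3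
  have f222 := hfou ({Fin.castAdd e 4} : Finset (Fin (6 + e))) ({Fin.castAdd e 4} : Finset (Fin (6 + e))) ({Fin.castAdd e 4} : Finset (Fin (6 + e))) (by norm_num) (by norm_num) (by norm_num) dv5 dv5 dv5
  simp only [sum_three h13 h15 h35, sum_pair h25, sum_singleton] at f000 f001 f002 f010 f011 f012 f020 f021 f022 f100 f101 f102 f110 f111
  simp only [sum_three h13 h15 h35, sum_pair h25, sum_singleton] at f112 f120 f121 f122 f200 f201 f202 f210 f211 f212 f220 f221 f222
  have hF := max3_add_max3_add_max3_le f000 f001 f002 f010 f011 f012 f020 f021 f022 f100 f101 f102 f110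
    f111 f112 f120 f121 f122 f200 f201 f202 f210 f211 f212 f220 f221 f222
  /- apply the linear programme -/
  have key := linear_program (a := ∑ i, expo Λ X i) (b := ∑ i, expo Λ Y i) (c := ∑ i, expo Λ Z i)
    (a₁ := expo Λ X (Fin.castAdd e 0)) (a₂ := expo Λ X (Fin.castAdd e 1)) (a₃ := expo Λ X (Fin.castAdd e 2)) (a₄ := expo Λ X (Fin.castAdd e 3)) (a₅ := expo Λ X (Fin.castAdd e 4)) (a₆ := expo Λ X (Fin.castAdd e 5))
    (b₁ := expo Λ Y (Fin.castAdd e 0)) (b₂ := expo Λ Y (Fin.castAdd e 1)) (b₃ := expo Λ Y (Fin.castAdd e 2)) (b₄ := expo Λ Y (Fin.castAdd e 3)) (b₅ := expo Λ Y (Fin.castAdd e 4)) (b₆ := expo Λ Y (Fin.castAdd e 5))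
    (c₁ := expo Λ Z (Fin.castAdd e 0)) (c₂ := expo Λ Z (Fin.castAdd e 1)) (c₃ := expo Λ Z (Fin.castAdd e 2)) (c₄ := expo Λ Z (Fin.castAdd e 3)) (c₅ := expo Λ Z (Fin.castAdd e 4)) (c₆ := expo Λ Z (Fin.castAdd e 5))
    (D := Real.logb Λ (shapeCount c₁ c₂ c₃ X Y Z)) (s := s)
    (sum_nonneg fun i _ => hα0 i) (sum_nonneg fun i _ => hβ0 i) (sum_nonneg fun i _ => hγ0 i)
    (hα0 (Fin.castAdd e 0)) (hα0 (Fin.castAdd e 1)) (hα0 (Fin.castAdd e 2)) (hα0 (Fin.castAdd e 3)) (hα0 (Fin.castAdd e 4)) (hα0 (Fin.castAdd e 5))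
    (hβ0 (Fin.castAdd e 0)) (hβ0 (Fin.castAdd e 1)) (hβ0 (Fin.castAdd e 2)) (hβ0 (Fin.castAdd e 3)) (hβ0 (Fin.castAdd e 4)) (hβ0 (Fin.castAdd e 5))
    (hγ0 (Fin.castAdd e 0)) (hγ0 (Fin.castAdd e 1)) (hγ0 (Fin.castAdd e 2)) (hγ0 (Fin.castAdd e 3)) (hγ0 (Fin.castAdd e 4)) (hγ0 (Fin.castAdd e 5))
    hs0 h1 h2a h2b h2c (by linarith [h3a]) (by linarith [h3b]) (by linarith [h3c])
    (by linarith [h4ab]) (by linarith [h4ac]) (by linarith [h4bc])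
    (by rcases g5 with h | h <;> [left; right] <;> linarith)
    (by rcases g6a with h | h <;> [left; right] <;> linarith)
    (by rcases g6b with h | h <;> [left; right] <;> linarith)
    (by rcases g6c with h | h <;> [left; right] <;> linarith)
    (by rcases g7ab with h | h <;> [left; right] <;> linarith)
    (by rcases g7bc with h | h <;> [left; right] <;> linarith)
    (by rcases g7ca with h | h <;> [left; right] <;> linarith)
    (by rcases g8a with h | h <;> [left; right] <;> linarith)
    (by rcases g8b with h | h <;> [left; right] <;> linarith)
    (by rcases g8c with h | h <;> [left; right] <;> linarith)
    (by rcases g9a with h | h <;> [left; right] <;> linarith)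
    (by rcases g9b with h | h <;> [left; right] <;> linarith)
    (by rcases g9c with h | h <;> [left; right] <;> linarith)
    hF
  exact key

end instance_

end AbcShapes

end Literature.NumberTheory.DiophantineGeometry
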